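import Mathlib.Analysis.Complex.Isometry
import Mathlib.Analysis.Complex.Circle
import Mathlib.Analysis.Convex.Segment
import Mathlib.Topology.Connected.PathConnected
import Literature.Probability.LatticeModels.LatticeGraph
import Literature.Probability.LatticeModels.DomainDiscretisation
import Literature.Probability.Percolation.Percolation
import Literature.Probability.RandomPlanarGeometry.ChordalCurveFamily
import HarnessLib

/-!
# Rotation invariance of quad-crossing probabilities for critical bond percolation on `δℤ²`
# (Duminil-Copin–Kozlowski–Krachun–Manolescu–Oulamara, `q = 1`)

Topic `Probability/Percolation` (family CriticalPhenomena; requested by route `CardyLogModulus`,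
crux `RotatedRectangleInvariance`, next to `dkkmo_rotation_invariance` of
`LoopRotationInvariance`, which vendors the loop/`d_CN` half of the DKKMO theorem).

## The Schramm–Smirnov crossing event of a quad (Schramm–Smirnov 2011, §1.3; DKKMO §1.2)

A *quad* is the image `Q` of `[0,1]²` under a homeomorphism into `ℂ`, with corners `a, b, c, d`;
"a crossing of `Q` is a continuous path in `Q` going from `(ab)` to `(cd)`" (DKKMO,
arXiv:2012.11672v1, §1.2, p. 4), and a bond configuration `ω` on `δℤ²` *crosses* `Q` if some open
path of `ω`, "seen as a continuous path in the plane" (loc. cit.), contains a crossing of `Q`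
(Schramm–Smirnov 2011, §1.3: a crossing is a connected compact subset of `[Q]` meeting the two
opposite sides `∂₀Q`, `∂₂Q`; "in the discrete setting there is no difference between connected
and path-connected crossings"). In the tree a quad with its four corners is a
`RandomPlanarGeometry.ConformalRectangle` `R` (a Jordan domain — bounded, with its boundary
Jordan curve — and four marked boundary points `R.pt 0, …, R.pt 3` in cyclic order; the closed
quad is `closure R.carrier`, the sides `(ab)`, `(cd)` are the arcs `R.arc 0`, `R.arc 2`; interiors
of quads are exactly Jordan domains by invariance of domain and the Schoenflies theorem), and:

* `openEdgeUnion δ ω ⊆ ℂ` — the union of the closed segments `[δx, δy]` of the open edges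
  `{x, y} ∈ ω` of `ℤ²`, drawn in the rescaled lattice `δℤ²` (`meshPoint δ`);
* `quadCrossing R δ` — the Schramm–Smirnov event `𝒞_δ(Q)`: some point of the arc `R.arc 0` is
  joined to some point of `R.arc 2` by a continuous path inside `closure R.carrier ∩
  openEdgeUnion δ ω` (Mathlib `JoinedIn`). A continuous path inside a union of lattice segments
  passes from one segment to another only through common lattice points, so this is the same as
  "some open lattice walk, drawn in the plane, contains a crossing of `Q`".
* `quadCrossingProb δ R = P_{1/2}[𝒞_δ(Q)]` under critical bond percolation
  `bondPercolation (zdGraph 2) half` (full plane).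

## The vendored fact (DKKMO, arXiv:2012.11672v1, Corollary 1.3, at `q = 1`)

Printed (v1, Cor. 1.3, p. 5): *Fix `q ∈ [1,4]` and a simply connected domain `Ω` with a
`C¹`-smooth boundary. For every `ε > 0` small enough, there exists `δ₀ = δ₀(q, ε, Ω) > 0` such
that for every quad `Q` with `ε`-neighborhood contained in `Ω`, every `α ∈ (ε, π - ε)`, and every
`δ < δ₀`, `|φ⁰_{(e^{iα}Ω)_δ}[𝒞(e^{iα}Q)] - φ⁰_{Ω_δ}[𝒞(Q)]| ≤ ε`.* At `q = 1` the random-cluster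
measure `φ⁰_{Ω_δ}` is Bernoulli bond percolation of parameter `p_c(1) = 1/2` on the edges of
`Ω_δ`, a product measure, and for a quad at distance `≥ ε` from `∂Ω` the event `𝒞(Q)` depends
only on edges inside `Q ⊆ Ω_δ` (`δ` small), so both probabilities are full-plane probabilities:
`|P_{1/2}[𝒞_δ(e^{iα}Q)] - P_{1/2}[𝒞_δ(Q)]| ≤ ε` — the crossing probability of the rotated quad
by `δℤ²` (equivalently of `Q` by `e^{-iα}δℤ²`) is within `ε` of that of `Q`.

`dkkmo_crossing_rotation_invariance` vendors this **for each quad**: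
`∀ Q, ∀ ε > 0, ∃ δ₀ > 0, ∀ α ∈ (ε, π - ε), ∀ δ ∈ (0, δ₀), |P[𝒞_δ(e^{iα}Q)] - P[𝒞_δ(Q)]| ≤ ε`,
i.e. with `δ₀ = δ₀(Q, ε)` — WEAKER than the printed order of quantifiers (`δ₀(q, ε, Ω)` uniform
over all quads with `ε`-neighbourhood in `Ω`) and exactly what the printed proof delivers ("the
result follows directly from Theorem 1.2 and the measurability of `𝒞(Q)` in the Schramm–Smirnov
topology", §7.1, p. 43, for a given quad). The uniform reading cannot be meant literally: it
includes quads of diameter smaller than the mesh `δ < δ₀`, for which `𝒞_δ(Q)` is decided by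
`O(1)` edges (e.g. a thin quad crossed by exactly one edge of `δℤ²` transversally has
`P[𝒞_δ(Q)] = 1/2` while a rotated copy meeting no edge suitably has probability `0`). The angle
range `(ε, π - ε)` is kept as printed (v1); all angles follow at `q = 1` from the symmetries of
`ℤ²`, and v2 (2026) of the paper proves an angle-uniform quantitative form for loops
(`dkkmo_rotation_invariance`), neither of which is asserted here.

## References

* [DKKMO2020Rotational] H. Duminil-Copin, K. K. Kozlowski, D. Krachun, I. Manolescu, M. Oulamara,
  *Rotational invariance in critical planar lattice models*, arXiv:2012.11672v1 (2020): §1.2 p. 4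
  (quads, crossings, `𝒞(Q)`), Cor. 1.3 p. 5, proof §7.1 p. 43 (held: `paper:arxiv-2012.11672`,
  read).
* [SchrammSmirnov2011] O. Schramm, S. Smirnov, *On the scaling limits of planar percolation*,
  Ann. Probab. 39 (2011), §1.3 (quads, crossings; held arXiv:1101.5820, read).
* [Tassion2024] V. Tassion, *Rotation invariance of critical planar percolation*, Sém. Bourbaki
  Exp. 1210, Astérisque (2024) (exposition of the `q = 1` case).

## Design notes

* Everything lattice-side is reused: `BondConfig`, `bondPercolation (zdGraph 2) half`,
  `meshPoint δ`; the quad is a `ConformalRectangle` and its rotation is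
  `R.map (rotation (Circle.exp α)).toHomeomorph` (`MarkedDomain.map`, whose arcs are the rotated
  arcs, `MarkedDomain.arc_map`), the same rotation `rotation (Circle.exp α)` as in
  `LoopRotationInvariance`.
* Only lattice edges contribute to `openEdgeUnion` (`(zdGraph 2).Adj x y`), so junk pairs in
  `ω ⊆ Sym2 (Site 2)` off the edge set (a `bondPercolation`-null event) are ignored.
* Probabilities are `μ.real` (as in `Crossings.discreteCrossingProb`); no measurability is
  claimed (for `δ > 0` the event depends on the finitely many edges meeting the bounded quad).
* This is Smirnov's/Schramm–Smirnov's *continuum-arc* crossing event, not the discrete-arc event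
  `discreteCrossing Ω δ A B` of `Crossings` (G02); transferring between the two for (rotated)
  rectangles is left to the consumer, as requested.
-/

noncomputable section

open MeasureTheory Set
open Literature.Probability.LatticeModels Literature.Probability.RandomPlanarGeometry

namespace Literature.Probability.Percolation

/-! ### Open edges drawn in the plane; the Schramm–Smirnov crossing event -/

/-- The open edges of the bond configuration `ω` on `ℤ²`, drawn in the rescaled lattice
`δℤ² ⊆ ℂ`: the union over the open lattice edges `{x, y} ∈ ω` (`x ∼ y` in `ℤ²`) of the closed
segments `[δx, δy]` ("an open path in `ω` seen as a continuous path in the plane", DKKMO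
arXiv:2012.11672v1, §1.2, p. 4; Schramm–Smirnov 2011, §1.3).
[cite: DKKMO2020Rotational, §1.2 p. 4] -/
def openEdgeUnion (δ : ℝ) (ω : BondConfig (Site 2)) : Set ℂ :=
  ⋃ (x : Site 2) (y : Site 2) (_ : (zdGraph 2).Adj x y) (_ : s(x, y) ∈ ω),
    segment ℝ (meshPoint δ x) (meshPoint δ y)

/-- Membership in `openEdgeUnion`, unfolded: `z` lies on the drawn segment of some open lattice
edge. [cite: DKKMO2020Rotational, §1.2 p. 4] -/
theorem mem_openEdgeUnion_iff {δ : ℝ} {ω : BondConfig (Site 2)} {z : ℂ} :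
    z ∈ openEdgeUnion δ ω ↔ ∃ x y : Site 2, (zdGraph 2).Adj x y ∧ s(x, y) ∈ ω ∧
      z ∈ segment ℝ (meshPoint δ x) (meshPoint δ y) := by
  simp only [openEdgeUnion, mem_iUnion, exists_prop]

/-- `openEdgeUnion δ` is monotone in the configuration: opening edges enlarges the drawn set.
[cite: DKKMO2020Rotational, §1.2 p. 4] -/
theorem openEdgeUnion_mono (δ : ℝ) {ω ω' : BondConfig (Site 2)} (h : ω ⊆ ω') :
    openEdgeUnion δ ω ⊆ openEdgeUnion δ ω' := by
  intro z hz
  obtain ⟨x, y, hxy, hω, hz⟩ := mem_openEdgeUnion_iff.1 hz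
  exact mem_openEdgeUnion_iff.2 ⟨x, y, hxy, h hω, hz⟩

/-- The **Schramm–Smirnov crossing event** `𝒞_δ(Q)` of the quad `Q = (closure R.carrier;
R.pt 0, R.pt 1, R.pt 2, R.pt 3)` at mesh `δ`: some point of the side `(ab) = R.arc 0` is joined
to some point of the opposite side `(cd) = R.arc 2` by a continuous path lying in the closed quad
and in the drawn open edges, i.e. some open path of `ω`, seen as a continuous path in the plane,
contains a crossing of `Q` ("a crossing of `Q` is a continuous path in `Q` going from `(ab)` to
`(cd)`", DKKMO arXiv:2012.11672v1, §1.2, p. 4; Schramm–Smirnov 2011, §1.3, `∂₀Q`, `∂₂Q`). Uses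
Mathlib's `JoinedIn`. [cite: DKKMO2020Rotational, §1.2 p. 4] -/
def quadCrossing (R : ConformalRectangle) (δ : ℝ) : Set (BondConfig (Site 2)) :=
  {ω | ∃ a ∈ R.arc 0, ∃ b ∈ R.arc 2, JoinedIn (closure R.carrier ∩ openEdgeUnion δ ω) a b}

/-- Membership in the quad-crossing event, unfolded. [cite: DKKMO2020Rotational, §1.2 p. 4] -/
theorem mem_quadCrossing_iff {R : ConformalRectangle} {δ : ℝ} {ω : BondConfig (Site 2)} :
    ω ∈ quadCrossing R δ ↔
      ∃ a ∈ R.arc 0, ∃ b ∈ R.arc 2, JoinedIn (closure R.carrier ∩ openEdgeUnion δ ω) a b :=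
  Iff.rfl

/-- The quad-crossing event is increasing (opening edges preserves crossings; Grimmett 1999 §2.1
for increasing events). [cite: DKKMO2020Rotational, §1.2 p. 4] -/
theorem isUpperSet_quadCrossing (R : ConformalRectangle) (δ : ℝ) :
    IsUpperSet (quadCrossing R δ) := by
  rintro ω ω' h ⟨a, ha, b, hb, hab⟩
  exact ⟨a, ha, b, hb, hab.mono (inter_subset_inter_right _ (openEdgeUnion_mono δ h))⟩

/-- The crossing probability `P_{1/2}[𝒞_δ(Q)]` of the quad under critical bond percolation on
`ℤ²` (full plane, `p = 1/2`), the lattice being drawn at mesh `δ` (DKKMO arXiv:2012.11672v1, §1.3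
at `q = 1`). [cite: DKKMO2020Rotational, §1.3] -/
def quadCrossingProb (δ : ℝ) (R : ConformalRectangle) : ℝ :=
  (bondPercolation (zdGraph 2) half).real (quadCrossing R δ)

/-- The quad rotated by the angle `α` about the origin: the image of `R` (carrier, boundary loop
and marked corners) under `z ↦ e^{iα} z`, Mathlib's `rotation (Circle.exp α)` as a homeomorphism
(DKKMO §1.3: "we identify the rotation by the angle `α` with the multiplication by `e^{iα}`").
Its sides are the rotated sides (`MarkedDomain.arc_map`). [cite: DKKMO2020Rotational, §1.3] -/
def rotateQuad (α : ℝ) (R : ConformalRectangle) : ConformalRectangle :=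
  R.map (rotation (Circle.exp α)).toHomeomorph

/-- The carrier of the rotated quad is the rotated carrier. [cite: DKKMO2020Rotational, §1.3] -/
@[simp] theorem carrier_rotateQuad (α : ℝ) (R : ConformalRectangle) :
    (rotateQuad α R).carrier = (fun z => rotation (Circle.exp α) z) '' R.carrier := rfl

/-- The sides of the rotated quad are the rotated sides. [cite: DKKMO2020Rotational, §1.3] -/
@[simp] theorem arc_rotateQuad (α : ℝ) (R : ConformalRectangle) (i : Fin 4) :
    (rotateQuad α R).arc i = (fun z => rotation (Circle.exp α) z) '' R.arc i :=
  MarkedDomain.arc_map _ _ i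

/-! ### DKKMO, Corollary 1.3 at `q = 1` -/

/-- **Rotation invariance of quad-crossing probabilities for critical bond percolation on `δℤ²`**
(Duminil-Copin–Kozlowski–Krachun–Manolescu–Oulamara, arXiv:2012.11672v1, Corollary 1.3, case
`q = 1`: "For every `ε > 0` small enough, there exists `δ₀ = δ₀(q, ε, Ω) > 0` such that for every
quad `Q` with `ε`-neighborhood contained in `Ω`, every `α ∈ (ε, π - ε)`, and every `δ < δ₀`,
`|φ⁰_{(e^{iα}Ω)_δ}[𝒞(e^{iα}Q)] - φ⁰_{Ω_δ}[𝒞(Q)]| ≤ ε`"; at `q = 1` both measures are Bernoulli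
bond percolation at `p = 1/2` and the events depend only on edges inside the quads, so the domain
`Ω` disappears). For every quad `Q` (a `ConformalRectangle`) and every `ε > 0` there is `δ₀ > 0`
such that for every angle `α ∈ (ε, π - ε)` and every mesh `δ ∈ (0, δ₀)`, the probability that the
rotated quad `e^{iα}Q` is crossed (between its sides `e^{iα}(ab)` and `e^{iα}(cd)`) by the open
edges of `δℤ²` differs from that of `Q` by at most `ε`. Vendored **per quad** (`δ₀ = δ₀(Q, ε)`),
which is weaker than the printed uniformity in `Q` and is what the printed proof yields; the
literal uniform reading fails for quads smaller than the mesh (module docstring). The transfer to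
the discrete-arc events `discreteCrossing` and to all angles is left to consumers.
[cite: DKKMO2020Rotational, Cor. 1.3 (q = 1)] -/
def dkkmo_crossing_rotation_invariance : Prop :=
  ∀ (R : ConformalRectangle) (ε : ℝ), 0 < ε →
    ∃ δ₀ : ℝ, 0 < δ₀ ∧ ∀ α ∈ Set.Ioo ε (Real.pi - ε), ∀ δ ∈ Set.Ioo (0 : ℝ) δ₀,
      |quadCrossingProb δ (rotateQuad α R) - quadCrossingProb δ R| ≤ ε

end Literature.Probability.Percolation
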